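import Mathlib.Analysis.Calculus.Implicit
import Mathlib.Analysis.SpecialFunctions.Exponential
import Literature.MathematicalPhysics.QuantumFieldTheory.Balaban1983to89.T4AdjointCovarianceUnitary
import Literature.MathematicalPhysics.QuantumFieldTheory.Balaban1983to89.Node00.WilsonActionFirstVariation

/-!
# NODE 00 — CRITICALITY ON A FIBRE: THE CURVE FORM ⇒ THE TANGENT FORM (82) UNDER A SUBMERSIVE CHART OF THE CONSTRAINT
# (the implicit-function step print takes for granted when it writes «dA∣_{𝔅(𝐁,V)}(U) = 0» as an equation on the tangent space (83))

Cell `pub-ymgap`, seat `pub-ymgap-dag-n07-e` generation 14 (R141 (C), DAG node N07 = [15] = [Balaban1985Variational]; MODULE 35a, INBOX INTENT-35a of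
2026-08-27 ≈21:05Z).  NEW leaf; this seat's `Node00.WilsonActionFirstVariation` (p525814: `hasDerivAt_wilsonAction4`, `hasDerivAt_coe_plaqHol`) and
`Node00.CriticalOnFibre` (`IsCritOnFibre`, `isCritOnFibre_atScale_iff`) and the tree's `T4AdjointCovarianceUnitary` (`lieSU n` = 𝔰𝔲(n) as a real normed
subspace of `M_n(ℂ)` with its pinned Hilbert–Schmidt norm, `expSU : 𝔰𝔲(n) → SU(n)`) CONSUMED BY NAME; Mathlib's finite-dimensional implicit-function theorem
(`HasStrictFDerivAt.implicitFunction`, `map_implicitFunction_eq`, `to_implicitFunction`, `implicitFunction_apply_image`).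
`--kind definition --supports stmt-QuantumFields-20541` (K0⁷: plan g77 V16 stub 1's token `Prop8RegSepTopStep` displays the reading this file addresses).

WHY.  Every N07 token of the tree states criticality of the Wilson action (5) on a fibre `𝔅(𝐁, W) = {U | Ū^j = W_j on Λ_j ∀ j}` in the CURVE form
(`IsCritOnFibre`, this seat g8; `IsCritOfRecord`, g2): «along every curve in the fibre through `U`, differentiable at `0`, the derivative of `A` vanishes».
Print ([15] Sect. F p. 300: «We will use only the fact that they are critical configurations of the functional (5) and that they belong to the spaces (6)»;
(141) p. 299: «⟨δA′, J⟩ = 0 for all δA′: QδA′ = 0, RD*δA′ = 0»; (82)–(83) p. 290: «the equation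
⟨(δ∕δA′)𝔉(A′), δA′⟩ = 0 (82) holds for all δA′ in the tangent space, that is δA′ satisfying QδA′ = 0, RD*δA′ = 0 (83)») uses the TANGENT form: `dA(U)·δU = 0`
for every `δU` in the kernel of the linearised constraint.  Curve form ⇒ tangent form is the implicit-function step «every kernel vector of the linearised
constraint is the velocity of a curve INSIDE the fibre», valid where the constraint map is a SUBMERSION (surjective derivative) — in print this is the rôle of the LINEARIZING TRANSFORMATION
`A = A′ − HD(A′)` ([15] Sect. C (47)–(49) p. 285, Prop. 3 p. 289: «the transformation (47) … linearizing the averaging operation Q(ηA) is defined and analytic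
… The range of this transformation contains the set (43)»; [6] Sect. E (1.113)–(1.114) pp. 95–97), in whose coordinates `A′` the constraint is LINEAR and the
tangent space is the kernel (83).  The referees display this as GAP-STATED(submersion) on every N07 token (ref-C READ-121
NOTE 2; ref-G READ153 LABEL-NOTE (d)).  This file proves the step MODULO an explicit submersive chart (a named hypothesis with a body, `IsFibreChartAt`,
never asserted); the canonical chart of the averaging of record and its surjectivity at small fields are the successor modules 35b–35d.

CONTENTS.
* §1 ABSTRACT: `exists_hasDerivAt_curve_of_mem_ker` — for `f : E → V` (real Banach `E`, finite-dimensional `V`) strictly differentiable at `a` with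
  SURJECTIVE derivative `f'`, every `X ∈ ker f'` is the velocity at `0` of a curve `c` with `c 0 = a` and `f (c t) = f a` for `t` near `0` (Mathlib's
  implicit function `g` along the ray `t ↦ g (f a) (t•X)`).
* §2 THE EXPONENTIAL CHART of `SU(N)^{bonds}` over the tree's `lieSU (Fin N)` ∕ `expSU`: `expChart U X = (b ↦ U_b·exp X_b)`, `expSU_zero`, `expChart_zero`,
  and the velocity lemmas `hasDerivAt_coe_expSU_along`, `hasDerivAt_coe_expChart_along` (a Lie-algebra curve `c`, `c 0 = 0`, `c′(0) = X` ⇒ bond-wise matrix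
  velocity `U_b·X_b`), `differentiableAt_coe_expChart_along`, `hasDerivAt_ray`.
* §3 `hasDerivAt_wilsonAction4_of_sameVelocity` (two curves through the same configuration with the same bond-wise velocities have the same derivative of
  (5) — p525814's formula), ★ the hypothesis `IsFibreChartAt F N K 𝐁 W U Φ Φ'` («`Φ` is a submersive chart of the constraint at `U`»: strictly differentiable
  at `0` with derivative `Φ'` ONTO a finite-dimensional space, and its level set through `0` lies in the fibre), ★★
  `hasDerivAt_wilsonAction4_expChart_of_isCritOnFibre` — CURVE-critical on the fibre ⇒ `d∕dt A(U·exp(tX))∣₀ = 0` for EVERY `X ∈ ker Φ'` (the tangent form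
  (82) on (83) in the chart `Φ`) —, its one-scale reading `…_of_isCritOfRecord`, and the sanity case of the EMPTY determining set (`isFibreChartAt_empty`:
  the constant chart to the zero space is submersive; `hasDerivAt_wilsonAction4_expChart_of_isCritOnFibre_empty`: unconstrained critical ⇒ every direction).
* §4 (v1.1, append-only) the LOCAL hypothesis `IsFibreChartNear` (level-set clause only for `X` near `0` — the form a logarithmic canonical chart satisfies),
  `IsFibreChartAt.near`, ★★ `hasDerivAt_wilsonAction4_expChart_of_isCritOnFibre_near`, `deriv_…_near`, `…_of_isCritOfRecord_near`.

HONEST FRAMING: finite-dimensional calculus on `SU(N)^{bonds}`; ONE definition with a body (`expChart`) and ONE `Prop`-valued hypothesis with a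
body (`IsFibreChartAt`), never asserted for the averaging of record (that is 35b–35d: the canonical chart
`X ↦ log(W⁻¹·Ū^j(U·exp X))∣_𝐁`, its strict differentiability from `ExpMeanLog.analyticAt_eml`, and its surjectivity at small fields); nothing of [15]'s
estimates; V16 stub 1 ∕ K0⁷ NOT closed; N07 NOT discharged; counts unmoved (5∕27); one finite T⁴ programme at fixed ε — NOT continuum ∕ ℝ⁴ ∕ OS ∕
mass gap ∕ Clay.  No `sorry`, no `instance`, no `notation`.
-/

noncomputable section

namespace Literature.MathematicalPhysics.QuantumFieldTheory.Balaban1983to89.Node00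

open Filter Topology
open T4Continuum (T4Family)
open B15DeterminingSets
open T4AdjointCovarianceUnitary (lieSU expSU coe_expSU mem_lieSU_iff)
open scoped Matrix.Norms.L2Operator

/-! ## §1  Abstract: kernel vectors of a surjective strict derivative are velocities of curves in the level set -/

section Abstract

variable {E V : Type*} [NormedAddCommGroup E] [NormedSpace ℝ E] [CompleteSpace E]
  [NormedAddCommGroup V] [NormedSpace ℝ V] [FiniteDimensional ℝ V]

/-- **THE IMPLICIT-FUNCTION STEP.**  If `f : E → V` (`E` a real Banach space, `V` finite-dimensional) has a strict Fréchet derivative `f'` at `a` which is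
ONTO, then every kernel vector `X` of `f'` is the velocity at `0` of a curve `c` with `c 0 = a` staying in the level set `{f = f a}` for `t` near `0`:
`c t = g (f a) (t•X)` with `g` Mathlib's implicit function (`f (g y z) = y` near `(f a, 0)`, `g (f a) 0 = a`, `D(g (f a))(0) = ` the inclusion of `ker f'`).
[cite: Balaban1985Variational, Sect. C (47)–(49) p.285, Prop. 3 p.289 (the linearizing transformation), (82)–(83) p.290, (141) p.299, p.300; Balaban1985RegularSpaces, (1.113)–(1.114) pp.95–97] -/
theorem exists_hasDerivAt_curve_of_mem_ker {f : E → V} {f' : E →L[ℝ] V} {a : E} (hf : HasStrictFDerivAt f f' a)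
    (hf' : (f' : E →ₗ[ℝ] V).range = ⊤) {X : E} (hX : f' X = 0) :
    ∃ c : ℝ → E, c 0 = a ∧ HasDerivAt c X 0 ∧ ∀ᶠ t in 𝓝 (0 : ℝ), f (c t) = f a := by
  have hXk : X ∈ (f' : E →ₗ[ℝ] V).ker := by
    rw [LinearMap.mem_ker]
    exact hX
  set v : (f' : E →ₗ[ℝ] V).ker := ⟨X, hXk⟩ with hv
  have hray : HasDerivAt (fun t : ℝ => t • v) v 0 := by
    have h := (hasDerivAt_id (0 : ℝ)).smul_const v
    rwa [one_smul] at h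
  have hray0 : Tendsto (fun t : ℝ => t • v) (𝓝 0) (𝓝 0) := by
    have h : Tendsto (fun t : ℝ => t • v) (𝓝 0) (𝓝 ((0 : ℝ) • v)) := hray.continuousAt.tendsto
    rwa [zero_smul] at h
  refine ⟨fun t => hf.implicitFunction f f' hf' (f a) (t • v), ?_, ?_, ?_⟩
  · show hf.implicitFunction f f' hf' (f a) ((0 : ℝ) • v) = a
    rw [zero_smul]
    exact hf.implicitFunction_apply_image hf'
  · have hg : HasStrictFDerivAt (hf.implicitFunction f f' hf' (f a)) (f' : E →ₗ[ℝ] V).ker.subtypeL 0 :=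
      hf.to_implicitFunction hf'
    have hcomp : HasDerivAt ((hf.implicitFunction f f' hf' (f a)) ∘ (fun t : ℝ => t • v))
        ((f' : E →ₗ[ℝ] V).ker.subtypeL v) 0 :=
      hg.hasFDerivAt.comp_hasDerivAt_of_eq (0 : ℝ) hray (by rw [zero_smul])
    exact hcomp
  · exact (tendsto_const_nhds.prodMk_nhds hray0).eventually (hf.map_implicitFunction_eq hf')

end Abstract

/-! ## §2  The exponential chart of `SU(N)^{bonds}`: `exp : 𝔰𝔲(N) → SU(N)` (the tree's `lieSU`, `expSU`), `expChart U X = U·exp X`, velocities -/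

section LieAlgebra

variable {N : ℕ}

/-- `exp 0 = 1` for the tree's `expSU : 𝔰𝔲(N) → SU(N)`. [cite: Balaban1985RegularSpaces, (1.10) p.77 (bookkeeping)] -/
@[simp] theorem expSU_zero : expSU (0 : lieSU (Fin N)) = 1 :=
  Subtype.ext (by rw [coe_expSU, Submodule.coe_zero, NormedSpace.exp_zero]; rfl)

/-- ★ **VELOCITY OF `exp` ALONG A LIE-ALGEBRA CURVE THROUGH `0`**: if `c : ℝ → 𝔰𝔲(N)` has `c 0 = 0` and derivative `X` at `0`, then `t ↦ exp (c t)` (as a matrix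
curve) has derivative `X` at `0` (`D exp(0) = id`, Mathlib `hasStrictFDerivAt_exp_zero`, restricted to real scalars). [cite: Balaban1985RegularSpaces, (1.10) p.77 (bookkeeping: first order of `exp`)] -/
theorem hasDerivAt_coe_expSU_along {c : ℝ → lieSU (Fin N)} {X : lieSU (Fin N)} (hc : HasDerivAt c X 0) (h0 : c 0 = 0) :
    HasDerivAt (fun t => ((expSU (c t) : SU N) : Matrix (Fin N) (Fin N) ℂ)) (X : Matrix (Fin N) (Fin N) ℂ) 0 := by
  have hval : HasDerivAt (fun t => ((c t : lieSU (Fin N)) : Matrix (Fin N) (Fin N) ℂ)) (X : Matrix (Fin N) (Fin N) ℂ) 0 :=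
    ((lieSU (Fin N)).subtypeL.hasFDerivAt).comp_hasDerivAt 0 hc
  have hexp : HasFDerivAt (NormedSpace.exp : Matrix (Fin N) (Fin N) ℂ → Matrix (Fin N) (Fin N) ℂ)
      ((1 : Matrix (Fin N) (Fin N) ℂ →L[ℂ] Matrix (Fin N) (Fin N) ℂ).restrictScalars ℝ) 0 :=
    ((hasStrictFDerivAt_exp_zero (𝕂 := ℂ) (𝔸 := Matrix (Fin N) (Fin N) ℂ)).hasFDerivAt).restrictScalars ℝ
  have h00 : (0 : Matrix (Fin N) (Fin N) ℂ) = ((c 0 : lieSU (Fin N)) : Matrix (Fin N) (Fin N) ℂ) := by rw [h0, Submodule.coe_zero]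
  have hcomp : HasDerivAt ((NormedSpace.exp : Matrix (Fin N) (Fin N) ℂ → Matrix (Fin N) (Fin N) ℂ) ∘
      (fun t => ((c t : lieSU (Fin N)) : Matrix (Fin N) (Fin N) ℂ)))
      (((1 : Matrix (Fin N) (Fin N) ℂ →L[ℂ] Matrix (Fin N) (Fin N) ℂ).restrictScalars ℝ) (X : Matrix (Fin N) (Fin N) ℂ)) 0 :=
    hexp.comp_hasDerivAt_of_eq 0 hval h00
  exact hcomp

end LieAlgebra

section Chart

variable {P : Params} {j : ℕ} {N : ℕ}

/-- **THE EXPONENTIAL CHART OF `SU(N)^{bonds}` AT `U`**: `expChart U X = (b ↦ U_b · exp X_b)` for a Lie-algebra field `X : bonds → 𝔰𝔲(N)` — every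
configuration near `U` is of this form and the bond-wise velocity of `t ↦ expChart U (tX)` is `U_b X_b` (print's `U = U₀ exp(iηA)`-type charts).
[cite: Balaban1985RegularSpaces, (1.10) p.77; Balaban1985Variational, (15) p.280] -/
def expChart (U : GaugeField P j (SU N)) (X : PBond P j → lieSU (Fin N)) : GaugeField P j (SU N) := fun b => U b * expSU (X b)

/-- The matrix of `expChart U X` at a bond is `U_b · exp X_b`. [cite: Balaban1985RegularSpaces, (1.10) p.77 (bookkeeping)] -/
theorem coe_expChart (U : GaugeField P j (SU N)) (X : PBond P j → lieSU (Fin N)) (b : PBond P j) :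
    ((expChart U X b : SU N) : Matrix (Fin N) (Fin N) ℂ) = (U b : Matrix (Fin N) (Fin N) ℂ) * NormedSpace.exp (X b : Matrix (Fin N) (Fin N) ℂ) := rfl

/-- The chart is centred at `U`: `expChart U 0 = U`. [cite: Balaban1985RegularSpaces, (1.10) p.77 (bookkeeping)] -/
@[simp] theorem expChart_zero (U : GaugeField P j (SU N)) : expChart U 0 = U := by
  funext b
  show U b * expSU (0 : lieSU (Fin N)) = U b
  rw [expSU_zero, mul_one]

/-- ★ **BOND-WISE VELOCITY OF THE CHART ALONG A LIE-ALGEBRA CURVE**: `c : ℝ → (bonds → 𝔰𝔲(N))` with `c 0 = 0` and `c′(0) = X` ⇒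
`t ↦ ↑(expChart U (c t) b)` has derivative `↑(U b)·↑(X b)` at `0`. [cite: Balaban1985RegularSpaces, (1.10) p.77 (bookkeeping)] -/
theorem hasDerivAt_coe_expChart_along {U : GaugeField P j (SU N)} {c : ℝ → PBond P j → lieSU (Fin N)} {X : PBond P j → lieSU (Fin N)}
    (hc : HasDerivAt c X 0) (h0 : c 0 = 0) (b : PBond P j) :
    HasDerivAt (fun t => ((expChart U (c t) b : SU N) : Matrix (Fin N) (Fin N) ℂ))
      ((U b : Matrix (Fin N) (Fin N) ℂ) * (X b : Matrix (Fin N) (Fin N) ℂ)) 0 := by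
  have hcb : HasDerivAt (fun t => c t b) (X b) 0 := (hasDerivAt_pi.1 hc) b
  have h0b : (fun t => c t b) 0 = 0 := by
    show c 0 b = 0
    rw [h0]
    rfl
  have h := (hasDerivAt_coe_expSU_along hcb h0b).const_mul (U b : Matrix (Fin N) (Fin N) ℂ)
  exact h

/-- The chart curve is differentiable at `0` as a curve of bond matrices (the shape `IsCritOnFibre` quantifies over). [cite: Balaban1985RegularSpaces, (1.10) p.77 (bookkeeping)] -/
theorem differentiableAt_coe_expChart_along {U : GaugeField P j (SU N)} {c : ℝ → PBond P j → lieSU (Fin N)} {X : PBond P j → lieSU (Fin N)}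
    (hc : HasDerivAt c X 0) (h0 : c 0 = 0) :
    DifferentiableAt ℝ (fun (t : ℝ) (b : PBond P j) => ((expChart U (c t) b : SU N) : Matrix (Fin N) (Fin N) ℂ)) 0 :=
  (hasDerivAt_pi.2 fun b => hasDerivAt_coe_expChart_along hc h0 b).differentiableAt

/-- The ray `t ↦ t•X` is a Lie-algebra curve through `0` with velocity `X`. [cite: Balaban1985RegularSpaces, (1.10) p.77 (bookkeeping)] -/
theorem hasDerivAt_ray (X : PBond P j → lieSU (Fin N)) : HasDerivAt (fun t : ℝ => t • X) X 0 := by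
  have h := (hasDerivAt_id (0 : ℝ)).smul_const X
  rw [one_smul] at h
  exact h

end Chart

/-! ## §3  Same velocities ⇒ same derivative of (5); the submersive-chart hypothesis; CURVE-critical ⇒ TANGENT-critical -/

section SameVelocity

variable {P : Params} {j : ℕ} {N : ℕ} [NeZero N]

/-- **TWO CURVES THROUGH THE SAME CONFIGURATION WITH THE SAME BOND-WISE VELOCITIES HAVE THE SAME DERIVATIVE OF THE WILSON ACTION (5)** — the derivative is
p525814's first-variation formula, which reads only the configuration and the velocities. [cite: Balaban1985Variational, (5) p.278 (bookkeeping)] -/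
theorem hasDerivAt_wilsonAction4_of_sameVelocity {γ₁ γ₂ : ℝ → GaugeField P j (SU N)} (h0 : γ₁ 0 = γ₂ 0)
    {Y : PBond P j → Matrix (Fin N) (Fin N) ℂ}
    (h₁ : ∀ b, HasDerivAt (fun t => ((γ₁ t b : SU N) : Matrix (Fin N) (Fin N) ℂ)) (Y b) 0)
    (h₂ : ∀ b, HasDerivAt (fun t => ((γ₂ t b : SU N) : Matrix (Fin N) (Fin N) ℂ)) (Y b) 0)
    {a : ℝ} (ha : HasDerivAt (fun t => wilsonAction4 (γ₁ t)) a 0) :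
    HasDerivAt (fun t => wilsonAction4 (γ₂ t)) a 0 := by
  have e₁ := hasDerivAt_wilsonAction4 h₁ (fun p => hasDerivAt_coe_plaqHol h₁ p)
  have e₂ := hasDerivAt_wilsonAction4 h₂ (fun p => hasDerivAt_coe_plaqHol h₂ p)
  rw [h0] at e₁
  rw [ha.unique e₁]
  exact e₂

end SameVelocity

section Tangent

variable (F : T4Family) (N : ℕ) [NeZero N]

/-- ★ **«`Φ` IS A SUBMERSIVE CHART OF THE CONSTRAINT `Ū = W` ON `𝐁` AT `U`»** — the HYPOTHESIS under which curve-criticality is tangent-criticality: a map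
`Φ` from the Lie-algebra fields `bonds → 𝔰𝔲(N)` (the exponential chart at `U`) to a finite-dimensional real normed space `V`, STRICTLY differentiable at `0`
with derivative `Φ'` ONTO `V`, whose level set through `0` lies in the fibre `𝔅(𝐁, W) = {U′ | AgreeOn 𝐁 (Ū′^•) W}` of the averaging of record.  Then
`ker Φ'` is (contained in) the tangent space of the fibre at `U` — print's (83).  The canonical instance (`Φ X = log(W⁻¹·Ū^j(U·exp X))` on the bonds of
`𝐁`, surjective at small fields) is NOT constructed here (modules 35b–35d); a `Prop` with a body, never asserted.
[cite: Balaban1985Variational, (3),(5)–(6) p.278, Sect. C (47)–(49) p.285, Prop. 3 p.289, (82)–(83) p.290, p.299; Balaban1985RegularSpaces, (1.113)–(1.114) pp.95–97; Balaban1988Convergent, (2.10)–(2.12) p.256] -/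
def IsFibreChartAt (K : ℕ) (𝔹 : DetSet (F.P K)) (W : MSField (F.P K) (SU N)) (U : GaugeField (F.P K) 0 (SU N))
    {V : Type*} [NormedAddCommGroup V] [NormedSpace ℝ V] [FiniteDimensional ℝ V]
    (Φ : (PBond (F.P K) 0 → lieSU (Fin N)) → V) (Φ' : (PBond (F.P K) 0 → lieSU (Fin N)) →L[ℝ] V) : Prop :=
  HasStrictFDerivAt Φ Φ' 0 ∧ (Φ' : (PBond (F.P K) 0 → lieSU (Fin N)) →ₗ[ℝ] V).range = ⊤ ∧
    ∀ X, Φ X = Φ 0 → AgreeOn 𝔹 (avgFamily (avOfRecord F N K) (expChart U X)) W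

variable {F N}

/-- ★★ **CURVE-CRITICAL ⇒ TANGENT-CRITICAL.**  If `U` is a critical configuration of (5) on the fibre `𝔅(𝐁, W)` in the CURVE form (`IsCritOnFibre`) and `Φ`
is a submersive chart of the constraint at `U` (`IsFibreChartAt`), then the derivative of `A` at `U` vanishes in EVERY kernel direction of `Φ'`:
`d∕dt A(U·exp(tX))∣_{t=0} = 0` for all `X` with `Φ' X = 0` — print's «(82) for all δA′ in the tangent space (83)», in the exponential chart.  Proof: the
implicit-function curve `c` of §1 (velocity `X`, `c 0 = 0`, `Φ (c t) = Φ 0`) gives the fibre curve `t ↦ U·exp(c t)` with bond-wise velocity `U·X`; along it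
`A′(0) = 0` by curve-criticality; the ray `t ↦ U·exp(tX)` has the same velocity, hence the same derivative (§3).
[cite: Balaban1985Variational, Sect. C (47) p.285, Prop. 3 p.289, (82)–(83) p.290, (141) p.299, p.300, Prop. 8 p.304; Balaban1985RegularSpaces, (1.113)–(1.114) pp.95–97] -/
theorem hasDerivAt_wilsonAction4_expChart_of_isCritOnFibre {K : ℕ} {𝔹 : DetSet (F.P K)} {W : MSField (F.P K) (SU N)}
    {U : GaugeField (F.P K) 0 (SU N)} {V : Type*} [NormedAddCommGroup V] [NormedSpace ℝ V] [FiniteDimensional ℝ V]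
    {Φ : (PBond (F.P K) 0 → lieSU (Fin N)) → V} {Φ' : (PBond (F.P K) 0 → lieSU (Fin N)) →L[ℝ] V}
    (hΦ : IsFibreChartAt F N K 𝔹 W U Φ Φ') (hcrit : IsCritOnFibre F N K 𝔹 W U)
    {X : PBond (F.P K) 0 → lieSU (Fin N)} (hX : Φ' X = 0) :
    HasDerivAt (fun t : ℝ => wilsonAction4 (expChart U (t • X))) 0 0 := by
  -- completeness of the (finite-dimensional) chart domain, for the pinned norm of `lieSU`
  haveI : @CompleteSpace (lieSU (Fin N)) (@PseudoMetricSpace.toUniformSpace _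
      (T4AdjointCovarianceUnitary.instSeminormedAddCommGroupLieSU (n := Fin N)).toPseudoMetricSpace) :=
    complete_of_proper
  obtain ⟨c, hc0, hcX, hcf⟩ := exists_hasDerivAt_curve_of_mem_ker hΦ.1 hΦ.2.1 hX
  have h₁ : ∀ b, HasDerivAt (fun t => ((expChart U (c t) b : SU N) : Matrix (Fin N) (Fin N) ℂ))
      ((U b : Matrix (Fin N) (Fin N) ℂ) * (X b : Matrix (Fin N) (Fin N) ℂ)) 0 :=
    hasDerivAt_coe_expChart_along hcX hc0
  have h₂ : ∀ b, HasDerivAt (fun t : ℝ => ((expChart U (t • X) b : SU N) : Matrix (Fin N) (Fin N) ℂ))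
      ((U b : Matrix (Fin N) (Fin N) ℂ) * (X b : Matrix (Fin N) (Fin N) ℂ)) 0 :=
    hasDerivAt_coe_expChart_along (U := U) (c := fun t : ℝ => t • X) (hasDerivAt_ray X) (zero_smul ℝ X)
  have h12 : (fun t => expChart U (c t)) 0 = (fun t : ℝ => expChart U (t • X)) 0 := by
    show expChart U (c 0) = expChart U ((0 : ℝ) • X)
    rw [hc0, zero_smul]
  have hγ0 : (fun t => expChart U (c t)) 0 = U := by
    show expChart U (c 0) = U
    rw [hc0, expChart_zero]
  have hfib : ∀ᶠ t in 𝓝 (0 : ℝ), AgreeOn 𝔹 (avgFamily (avOfRecord F N K) ((fun t => expChart U (c t)) t)) W :=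
    hcf.mono fun t ht => hΦ.2.2 (c t) ht
  have hd : DifferentiableAt ℝ
      (fun (t : ℝ) (b : PBond (F.P K) 0) => (((fun t => expChart U (c t)) t b : SU N) : Matrix (Fin N) (Fin N) ℂ)) 0 :=
    differentiableAt_coe_expChart_along hcX hc0
  have ha := hasDerivAt_wilsonAction4 h₁ (fun p => hasDerivAt_coe_plaqHol h₁ p)
  have ha0 := hcrit (fun t => expChart U (c t)) hγ0 hd hfib _ ha
  rw [ha0] at ha
  exact hasDerivAt_wilsonAction4_of_sameVelocity h12 h₁ h₂ ha

/-- The same with the conclusion as the vanishing of the plain derivative `deriv`. [cite: Balaban1985Variational, (82) p.290 (bookkeeping)] -/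
theorem deriv_wilsonAction4_expChart_eq_zero_of_isCritOnFibre {K : ℕ} {𝔹 : DetSet (F.P K)} {W : MSField (F.P K) (SU N)}
    {U : GaugeField (F.P K) 0 (SU N)} {V : Type*} [NormedAddCommGroup V] [NormedSpace ℝ V] [FiniteDimensional ℝ V]
    {Φ : (PBond (F.P K) 0 → lieSU (Fin N)) → V} {Φ' : (PBond (F.P K) 0 → lieSU (Fin N)) →L[ℝ] V}
    (hΦ : IsFibreChartAt F N K 𝔹 W U Φ Φ') (hcrit : IsCritOnFibre F N K 𝔹 W U)
    {X : PBond (F.P K) 0 → lieSU (Fin N)} (hX : Φ' X = 0) :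
    deriv (fun t : ℝ => wilsonAction4 (expChart U (t • X))) 0 = 0 :=
  (hasDerivAt_wilsonAction4_expChart_of_isCritOnFibre hΦ hcrit hX).deriv

/-- **ONE-SCALE READING** (the no-holes pin `𝔅_k(V) = {U | Ū^k = V}` of this seat's g2 `IsCritOfRecord`, via `isCritOnFibre_atScale_iff`): a critical
configuration of (5) on `𝔅_k(W_k)` in the curve form is tangent-critical in every kernel direction of a submersive chart of `Ū^k = W_k`.
[cite: Balaban1985Variational, (3),(5) p.278, (82)–(83) p.290, (141) p.299, p.300] -/
theorem hasDerivAt_wilsonAction4_expChart_of_isCritOfRecord {K k : ℕ} {W : MSField (F.P K) (SU N)}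
    {U : GaugeField (F.P K) 0 (SU N)} {V : Type*} [NormedAddCommGroup V] [NormedSpace ℝ V] [FiniteDimensional ℝ V]
    {Φ : (PBond (F.P K) 0 → lieSU (Fin N)) → V} {Φ' : (PBond (F.P K) 0 → lieSU (Fin N)) →L[ℝ] V}
    (hΦ : IsFibreChartAt F N K (atScale k) W U Φ Φ') (hcrit : IsCritOfRecord F N K k (W k) U)
    {X : PBond (F.P K) 0 → lieSU (Fin N)} (hX : Φ' X = 0) :
    HasDerivAt (fun t : ℝ => wilsonAction4 (expChart U (t • X))) 0 0 :=
  hasDerivAt_wilsonAction4_expChart_of_isCritOnFibre hΦ ((isCritOnFibre_atScale_iff k W U).2 hcrit) hX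

/-- **SANITY: THE EMPTY DETERMINING SET.**  With NO constraint (`𝐁_j = ∅` for every `j`) the constant chart to the zero space `Fin 0 → ℝ` is submersive at
every `U` (its derivative `0` is onto the zero space; every level set is everything) — `IsFibreChartAt` is inhabited. [cite: Balaban1988Convergent, (2.10) p.256 (bookkeeping: the degenerate determining set)] -/
theorem isFibreChartAt_empty (K : ℕ) (W : MSField (F.P K) (SU N)) (U : GaugeField (F.P K) 0 (SU N)) :
    IsFibreChartAt F N K (fun _ => (∅ : Set _)) W U (fun _ : PBond (F.P K) 0 → lieSU (Fin N) => (0 : Fin 0 → ℝ))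
      (0 : (PBond (F.P K) 0 → lieSU (Fin N)) →L[ℝ] (Fin 0 → ℝ)) := by
  refine ⟨hasStrictFDerivAt_const (0 : Fin 0 → ℝ) 0, ?_, ?_⟩
  · exact eq_top_iff.2 fun v _ => ⟨0, Subsingleton.elim _ _⟩
  · intro X _ i b hb
    simp [bondsOf] at hb

/-- **SANITY: UNCONSTRAINED CRITICAL ⇒ EVERY DIRECTIONAL DERIVATIVE OF (5) VANISHES** — the empty-fibre case of ★★: a configuration critical on the fibre of
the EMPTY determining set (no constraint at all) has `d∕dt A(U·exp(tX))∣₀ = 0` for every Lie-algebra field `X` (the unconstrained lattice Yang–Mills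
equation in weak form). [cite: Balaban1985Variational, (5) p.278, Sect. F p.300 («critical configurations of the functional (5)»)] -/
theorem hasDerivAt_wilsonAction4_expChart_of_isCritOnFibre_empty {K : ℕ} {W : MSField (F.P K) (SU N)} {U : GaugeField (F.P K) 0 (SU N)}
    (hcrit : IsCritOnFibre F N K (fun _ => (∅ : Set _)) W U) (X : PBond (F.P K) 0 → lieSU (Fin N)) :
    HasDerivAt (fun t : ℝ => wilsonAction4 (expChart U (t • X))) 0 0 :=
  hasDerivAt_wilsonAction4_expChart_of_isCritOnFibre (isFibreChartAt_empty K W U) hcrit (by simp)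

end Tangent

/-! ## §4  (v1.1) The LOCAL chart hypothesis — the form a canonical chart satisfies: its level set through `0` lies in the fibre NEAR `0` -/

section Local

variable (F : T4Family) (N : ℕ) [NeZero N]

/-- ★ **«`Φ` IS A SUBMERSIVE CHART OF THE CONSTRAINT NEAR `U`» (LOCAL FORM, v1.1)** — as `IsFibreChartAt` but with the level-set clause only for `X` NEAR `0`:
`HasStrictFDerivAt Φ Φ' 0`, `Φ'` onto, and `∀ᶠ X in 𝓝 0, Φ X = Φ 0 → U·exp X ∈ 𝔅(𝐁, W)`.  This is the form the canonical chart `X ↦ log(W⁻¹·Ū^j(U·exp X))∣_𝐁`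
(modules 35b–35d) satisfies — a logarithmic chart is injective only near the identity —, and it is all the implicit-function step uses (its curve tends to `0`).
A `Prop` with a body, never asserted here. [cite: Balaban1985Variational, (3),(5)–(6) p.278, Sect. C (47)–(49) p.285, Prop. 3 p.289, (82)–(83) p.290; Balaban1985RegularSpaces, (1.113)–(1.114) pp.95–97; Balaban1988Convergent, (2.10)–(2.12) p.256] -/
def IsFibreChartNear (K : ℕ) (𝔹 : DetSet (F.P K)) (W : MSField (F.P K) (SU N)) (U : GaugeField (F.P K) 0 (SU N))
    {V : Type*} [NormedAddCommGroup V] [NormedSpace ℝ V] [FiniteDimensional ℝ V]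
    (Φ : (PBond (F.P K) 0 → lieSU (Fin N)) → V) (Φ' : (PBond (F.P K) 0 → lieSU (Fin N)) →L[ℝ] V) : Prop :=
  HasStrictFDerivAt Φ Φ' 0 ∧ (Φ' : (PBond (F.P K) 0 → lieSU (Fin N)) →ₗ[ℝ] V).range = ⊤ ∧
    ∀ᶠ X in 𝓝 (0 : PBond (F.P K) 0 → lieSU (Fin N)), Φ X = Φ 0 → AgreeOn 𝔹 (avgFamily (avOfRecord F N K) (expChart U X)) W

variable {F N}

/-- The global hypothesis implies the local one. [cite: Balaban1985Variational, (82)–(83) p.290 (bookkeeping)] -/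
theorem IsFibreChartAt.near {K : ℕ} {𝔹 : DetSet (F.P K)} {W : MSField (F.P K) (SU N)} {U : GaugeField (F.P K) 0 (SU N)}
    {V : Type*} [NormedAddCommGroup V] [NormedSpace ℝ V] [FiniteDimensional ℝ V]
    {Φ : (PBond (F.P K) 0 → lieSU (Fin N)) → V} {Φ' : (PBond (F.P K) 0 → lieSU (Fin N)) →L[ℝ] V}
    (h : IsFibreChartAt F N K 𝔹 W U Φ Φ') : IsFibreChartNear F N K 𝔹 W U Φ Φ' :=
  ⟨h.1, h.2.1, Eventually.of_forall h.2.2⟩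

/-- ★★ **CURVE-CRITICAL ⇒ TANGENT-CRITICAL, LOCAL CHART (v1.1)**: the conclusion of `hasDerivAt_wilsonAction4_expChart_of_isCritOnFibre` under the local
hypothesis `IsFibreChartNear` — the implicit-function curve `c` is continuous at `0` with `c 0 = 0`, so for `t` near `0` it lies where the level-set clause holds.
[cite: Balaban1985Variational, Sect. C (47) p.285, Prop. 3 p.289, (82)–(83) p.290, (141) p.299, p.300, Prop. 8 p.304; Balaban1985RegularSpaces, (1.113)–(1.114) pp.95–97] -/
theorem hasDerivAt_wilsonAction4_expChart_of_isCritOnFibre_near {K : ℕ} {𝔹 : DetSet (F.P K)} {W : MSField (F.P K) (SU N)}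
    {U : GaugeField (F.P K) 0 (SU N)} {V : Type*} [NormedAddCommGroup V] [NormedSpace ℝ V] [FiniteDimensional ℝ V]
    {Φ : (PBond (F.P K) 0 → lieSU (Fin N)) → V} {Φ' : (PBond (F.P K) 0 → lieSU (Fin N)) →L[ℝ] V}
    (hΦ : IsFibreChartNear F N K 𝔹 W U Φ Φ') (hcrit : IsCritOnFibre F N K 𝔹 W U)
    {X : PBond (F.P K) 0 → lieSU (Fin N)} (hX : Φ' X = 0) :
    HasDerivAt (fun t : ℝ => wilsonAction4 (expChart U (t • X))) 0 0 := by
  haveI : @CompleteSpace (lieSU (Fin N)) (@PseudoMetricSpace.toUniformSpace _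
      (T4AdjointCovarianceUnitary.instSeminormedAddCommGroupLieSU (n := Fin N)).toPseudoMetricSpace) :=
    complete_of_proper
  obtain ⟨c, hc0, hcX, hcf⟩ := exists_hasDerivAt_curve_of_mem_ker hΦ.1 hΦ.2.1 hX
  have h₁ : ∀ b, HasDerivAt (fun t => ((expChart U (c t) b : SU N) : Matrix (Fin N) (Fin N) ℂ))
      ((U b : Matrix (Fin N) (Fin N) ℂ) * (X b : Matrix (Fin N) (Fin N) ℂ)) 0 :=
    hasDerivAt_coe_expChart_along hcX hc0
  have h₂ : ∀ b, HasDerivAt (fun t : ℝ => ((expChart U (t • X) b : SU N) : Matrix (Fin N) (Fin N) ℂ))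
      ((U b : Matrix (Fin N) (Fin N) ℂ) * (X b : Matrix (Fin N) (Fin N) ℂ)) 0 :=
    hasDerivAt_coe_expChart_along (U := U) (c := fun t : ℝ => t • X) (hasDerivAt_ray X) (zero_smul ℝ X)
  have h12 : (fun t => expChart U (c t)) 0 = (fun t : ℝ => expChart U (t • X)) 0 := by
    show expChart U (c 0) = expChart U ((0 : ℝ) • X)
    rw [hc0, zero_smul]
  have hγ0 : (fun t => expChart U (c t)) 0 = U := by
    show expChart U (c 0) = U
    rw [hc0, expChart_zero]
  have hct : Tendsto c (𝓝 0) (𝓝 0) := by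
    have h : Tendsto c (𝓝 0) (𝓝 (c 0)) := hcX.continuousAt.tendsto
    rwa [hc0] at h
  have hfib : ∀ᶠ t in 𝓝 (0 : ℝ), AgreeOn 𝔹 (avgFamily (avOfRecord F N K) ((fun t => expChart U (c t)) t)) W :=
    (hct.eventually hΦ.2.2).mp (hcf.mono fun t ht h => h ht)
  have hd : DifferentiableAt ℝ
      (fun (t : ℝ) (b : PBond (F.P K) 0) => (((fun t => expChart U (c t)) t b : SU N) : Matrix (Fin N) (Fin N) ℂ)) 0 :=
    differentiableAt_coe_expChart_along hcX hc0
  have ha := hasDerivAt_wilsonAction4 h₁ (fun p => hasDerivAt_coe_plaqHol h₁ p)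
  have ha0 := hcrit (fun t => expChart U (c t)) hγ0 hd hfib _ ha
  rw [ha0] at ha
  exact hasDerivAt_wilsonAction4_of_sameVelocity h12 h₁ h₂ ha

/-- The same with the conclusion as `deriv … 0 = 0` (local chart). [cite: Balaban1985Variational, (82) p.290 (bookkeeping)] -/
theorem deriv_wilsonAction4_expChart_eq_zero_of_isCritOnFibre_near {K : ℕ} {𝔹 : DetSet (F.P K)} {W : MSField (F.P K) (SU N)}
    {U : GaugeField (F.P K) 0 (SU N)} {V : Type*} [NormedAddCommGroup V] [NormedSpace ℝ V] [FiniteDimensional ℝ V]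
    {Φ : (PBond (F.P K) 0 → lieSU (Fin N)) → V} {Φ' : (PBond (F.P K) 0 → lieSU (Fin N)) →L[ℝ] V}
    (hΦ : IsFibreChartNear F N K 𝔹 W U Φ Φ') (hcrit : IsCritOnFibre F N K 𝔹 W U)
    {X : PBond (F.P K) 0 → lieSU (Fin N)} (hX : Φ' X = 0) :
    deriv (fun t : ℝ => wilsonAction4 (expChart U (t • X))) 0 = 0 :=
  (hasDerivAt_wilsonAction4_expChart_of_isCritOnFibre_near hΦ hcrit hX).deriv

/-- **ONE-SCALE READING, LOCAL CHART (v1.1)** — `IsCritOfRecord` on `𝔅_k(W_k)` ⇒ tangent-critical in every kernel direction of a local submersive chart of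
`Ū^k = W_k`. [cite: Balaban1985Variational, (3),(5) p.278, (82)–(83) p.290, (141) p.299, p.300] -/
theorem hasDerivAt_wilsonAction4_expChart_of_isCritOfRecord_near {K k : ℕ} {W : MSField (F.P K) (SU N)}
    {U : GaugeField (F.P K) 0 (SU N)} {V : Type*} [NormedAddCommGroup V] [NormedSpace ℝ V] [FiniteDimensional ℝ V]
    {Φ : (PBond (F.P K) 0 → lieSU (Fin N)) → V} {Φ' : (PBond (F.P K) 0 → lieSU (Fin N)) →L[ℝ] V}
    (hΦ : IsFibreChartNear F N K (atScale k) W U Φ Φ') (hcrit : IsCritOfRecord F N K k (W k) U)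
    {X : PBond (F.P K) 0 → lieSU (Fin N)} (hX : Φ' X = 0) :
    HasDerivAt (fun t : ℝ => wilsonAction4 (expChart U (t • X))) 0 0 :=
  hasDerivAt_wilsonAction4_expChart_of_isCritOnFibre_near hΦ ((isCritOnFibre_atScale_iff k W U).2 hcrit) hX

end Local

end Literature.MathematicalPhysics.QuantumFieldTheory.Balaban1983to89.Node00

end
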